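import Summits.ResolutionOfSingularities.ResolutionOfSingularities.Theorems.PurelyInseparableDim4ChartZigzagStep
import Summits.ResolutionOfSingularities.ResolutionOfSingularities.Theorems.PurelyInseparableDim4AtlasMemberDefs
import HarnessLib

/-!
# Purely inseparable four-folds: a linear escaping centre lies OVER THE PARENT'S BASE with `x_i = b_i` (`i ∈ S″ ∖ S`) fixed
# (brick S3 (c) v4, tranche 1, brick A1f; cell `res-dim4-pi`)

[OURS · counted 0] (D-0157 DOOR 2; host item stmt-ResolutionOfSingularities-16155, helper). Nothing here proves resolution of
singularities in dimension ≥ 4 / characteristic `p`. Model-side input of step (3) of the A1 proof architecture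
(`res-dim4-typ-3/S3c-V4-ATLAS-MEMBERS-DESIGN.md` §10): a set `Zs ⊆ Bl` (`B : Bl → 𝔸⁵` any blowing up of `V(z, x_S)`) covered by translated
charts `Spec Θ_m ≫ chartImm_m` (`m ∈ P ⊆ S`, `Θ_m x_i = x_i + b_i`, `b|_S = 0`) on which it reads inside `V(z, x_{T_m})` with `m ∈ T_m` and
`S″ ∖ S ⊆ T_m`, projects under `B` into `ownedSetZ S {(i, b_i) : i ∈ S″ ∖ S}` = `V(z, x_S) ∩ {x_i = b_i : i ∈ S″ ∖ S}` — the parent's base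
with the free coordinates of the child fixed; with the fibre-closedness clause of `MemberAtlasZF` (DefsTwo) and `zigzag_transport_isClosed'`
(A1e) this makes the transported child CLOSED in the stage.

* **`apply_mem_ownedSetZ_of_cover_readings`**. AI-produced formalisation, weaker than expert review.
bears_on: LADDER-RESOLUTION:D157-DOOR2 (res-dim4-pi · S3 (c) v4 A1f).
-/

set_option linter.dupNamespace false -- D-0017: single-problem summit path `Summit.<S>.<S>.…` by design

noncomputable section

open MvPolynomial Finset CategoryTheory AlgebraicGeometry Opposite TopologicalSpace

namespace Summit.ResolutionOfSingularities.ResolutionOfSingularities.Theorems.PIDim4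

open Literature.AlgebraicGeometry.Resolution
open Literature.AlgebraicGeometry.Resolution.AffinePointBlowup (P A γ coord Wtop ξ)

namespace Equimultiple

section CentreBase

variable {K : Type} [Field K] [DecidableEq K] {S : Finset (Fin 4)} {Bl : Scheme.{0}} {B : Bl ⟶ P 4 K}

/-- **A linear escaping centre lies over the parent's base with the child's free coordinates fixed.** See the module docstring.
[cite: BierstoneGrigorievMilmanWlodarczyk2011, §4 Step 2b] [cite: Hauser2010, §G (chart expressions)] -/
theorem apply_mem_ownedSetZ_of_cover_readings
    (hB : IsBlowup B (AffineCoordBlowup.𝓘Λ 4 K (insert 0 (Fin.succ '' (S : Set (Fin 4))))))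
    (Pc : Finset (Fin 4)) (hP : ∀ m ∈ Pc, m ∈ S) (Θ : Fin 4 → (A 4 K ≃ₐ[K] A 4 K)) {b : Fin 4 → K}
    (hΘ : ∀ m ∈ Pc, ∀ i : Fin 4, Θ m (X i.succ) = X i.succ + C (b i)) (hbS : ∀ i ∈ S, b i = 0)
    (S'' : Finset (Fin 4)) (Tm : Fin 4 → Finset (Fin 4)) (hTm : ∀ m ∈ Pc, m ∈ Tm m ∧ S'' \ S ⊆ Tm m)
    (Zs : Set Bl)
    (hcov : Zs ⊆ ⋃ (m : Fin 4) (hm : m ∈ Pc), Set.range (Spec.map (CommRingCat.ofHom (Θ m : A 4 K →+* A 4 K)) ≫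
      AffineCoordBlowup.chartImm hB (ChartDictionary.succ_mem_centreVars (hP m hm))))
    (hread : ∀ m (hm : m ∈ Pc), Zs ∩ Set.range (Spec.map (CommRingCat.ofHom (Θ m : A 4 K →+* A 4 K)) ≫
        AffineCoordBlowup.chartImm hB (ChartDictionary.succ_mem_centreVars (hP m hm))) ⊆
      (Spec.map (CommRingCat.ofHom (Θ m : A 4 K →+* A 4 K)) ≫
        AffineCoordBlowup.chartImm hB (ChartDictionary.succ_mem_centreVars (hP m hm))) ''
        (AffineCoordBlowup.CΛ 4 K (insert 0 (Fin.succ '' (Tm m : Set (Fin 4)))) : Set (P 4 K)))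
    {z : Bl} (hz : z ∈ Zs) :
    B z ∈ ownedSetZ S ((S'' \ S).image fun i => (i, b i)) := by
  -- the chart that sees `z`, and the point `y ∈ V(z, x_{T_m})` it comes from
  obtain ⟨m, hm, hzm⟩ : ∃ m, ∃ hm : m ∈ Pc, z ∈ Set.range (Spec.map (CommRingCat.ofHom (Θ m : A 4 K →+* A 4 K)) ≫
      AffineCoordBlowup.chartImm hB (ChartDictionary.succ_mem_centreVars (hP m hm))) := by
    simpa only [Set.mem_iUnion] using hcov hz
  obtain ⟨y, hy, rfl⟩ := hread m hm ⟨hz, hzm⟩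
  have hy' := (AffineCoordBlowup.mem_CΛ_iff' 4 K _ y).mp hy
  have hXm : (X m.succ : A 4 K) ∈ y.asIdeal := hy' m.succ (ChartDictionary.succ_mem_centreVars (hTm m hm).1)
  have hs : ∀ k : Fin 4, (Θ m : A 4 K →+* A 4 K) (X k.succ) = X k.succ + C (b k) := fun k => hΘ m hm k
  have hbm : b m = 0 := hbS m (hP m hm)
  -- `B ∘ (Spec Θ_m ≫ chartImm_m) = Spec (Θ_m ∘ ψ_m)`
  have hmem : ∀ f : A 4 K, f ∈ (B ((Spec.map (CommRingCat.ofHom (Θ m : A 4 K →+* A 4 K)) ≫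
      AffineCoordBlowup.chartImm hB (ChartDictionary.succ_mem_centreVars (hP m hm))) y)).asIdeal ↔
      (Θ m : A 4 K →+* A 4 K) (coordBlowupSubst K (insert 0 (Fin.succ '' (S : Set (Fin 4)))) m.succ f) ∈ y.asIdeal := by
    intro f
    rw [← Scheme.Hom.comp_apply, ChartDictionary.chart_comp_eq_specMap hB (ChartDictionary.succ_mem_centreVars (hP m hm)),
      Spec.map_apply, PrimeSpectrum.comap_asIdeal, Ideal.mem_comap, CommRingCat.hom_ofHom, RingHom.comp_apply,
      AlgHom.toRingHom_eq_coe, AlgHom.coe_toRingHom]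
  refine ⟨?_, fun iv hiv => ?_⟩
  · -- over the parent `V(z, x_S)`
    rw [SetLike.mem_coe, AffineCoordBlowup.mem_CΛ_iff']
    rintro k (rfl | ⟨i, hi, rfl⟩)
    · rw [hmem, ChartDictionary.clean_subst_X_zero hbm hs]
      exact Ideal.mul_mem_right _ _ hXm
    · by_cases him : i = m
      · subst him
        rw [hmem, ChartDictionary.clean_subst_X_chart hbm hs]
        exact hXm
      · rw [hmem, ChartDictionary.clean_subst_X_fibre hbm hs hi him]
        exact Ideal.mul_mem_right _ _ hXm
  · -- the free coordinates of the child are fixed: `x_i = b_i`, `i ∈ S″ ∖ S`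
    obtain ⟨i, hi, rfl⟩ := Finset.mem_image.mp hiv
    obtain ⟨-, hiS⟩ := Finset.mem_sdiff.mp hi
    have hC : (Θ m : A 4 K →+* A 4 K) (C (b i)) = C (b i) := (Θ m).commutes (b i)
    change (X i.succ - C (b i) : A 4 K) ∈ _
    rw [hmem, map_sub, map_sub, ChartDictionary.clean_subst_X_base hs hiS, coordBlowupSubst_C, hC, add_sub_cancel_right]
    exact hy' i.succ (ChartDictionary.succ_mem_centreVars ((hTm m hm).2 hi))

end CentreBase

end Equimultiple

end Summit.ResolutionOfSingularities.ResolutionOfSingularities.Theorems.PIDim4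

end
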